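/-
Copyright (c) 2026 the pub-hodgecm-mathlib formalisation cell (harness21).  Prover seat hodgecm-mathlib-K2Liu-p03 (g6): Track B «K2-LIT»,
#184♮ = hLiu418 = stmt-HodgeConjecture-24832, road `K2_Liu`, Road I organ (A-int)-fin, D1 at RANK ONE: the Gindikin–Karpelevich scalar in the
`L`-factor currency of ★ T1 `K2LiuLocalLFactorDefs` (the «`aNorm_one` ↔ `K2LiuGKRankOneIdentity`» bridge, SIGS v3.13 §A-int; RULING M-156i §3 (c)).
-/
import Summits.HodgeConjecture.HodgeConjecture.Theorems.K2LiuGKRankOneIdentity        -- ★ p858192 `localIntertwining_eq_rankOne`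
import Summits.HodgeConjecture.HodgeConjecture.Theorems.K2LiuLocalLFactorDefs          -- ★ T1 p858302 `chiF`, `unramValue`, `lF`, `aNorm`, `aNorm_one`
import Literature.NumberTheory.Automorphic.QuadraticLocalNormCompatibility              -- ★ `norm_algebraNorm_localRing` (`‖N y‖_v = ∏_w ‖y_w‖_w`)
import Literature.NumberTheory.Automorphic.AdicCompletionUniformizerResidueCardGlue     -- ★ `residueFieldCard_adicCompletion_eq_absNorm`
import Literature.NumberTheory.GaloisRepresentations.AdicCompletionUniformizer          -- ★ `norm_eq_absNorm_zpow`
import HarnessLib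

/-!
# Crux `HLiu418`, road `K2_Liu`, Road I organ (A-int)-fin, D1 at RANK ONE: the Gindikin–Karpelevich identity in `L`-FACTOR CURRENCY
# `M_v(s) φ°_s = aNorm 1 χ_v (νN(N_Δ ∩ K_v)) s · φ°′ = νN(N_Δ ∩ K_v) · L_v(2s, χ_F)/L_v(2s+1, χ_F) · φ°′`

Cell `hodgecm-mathlib`, crux item hLiu418 = `stmt-HodgeConjecture-24832`; squad K2 ∕ K2Liu; prover K2Liu-p03 (g6).  THEOREMS ONLY (no `def`, no
`instance`, no notation, no named-fact hypothesis, no `sorry`); lane `--supports stmt-HodgeConjecture-24832` (count-neutral helper).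

THE MATHEMATICS.  ★ `K2LiuGKRankOneIdentity.localIntertwining_eq_rankOne` computes, at a good place `v` of the quadratic extension `E/F`
(`|2|_w = |δ|_w = 1`, `T₀`, `T₀⁻¹` integral, `χ_w` unramified), `M_v φ° (h) = νN(N_Δ ∩ K_v) · (1 − t)/(1 − q_v t) · φ°′(h)` with the «raw» parameter
`t = (∏_{w∣v} χ_w(ι_w ϖ)) · (∏_{w∣v} ‖ι_w ϖ‖_w)^{s+½}`.  This file supplies the dictionary to the `L`-factor currency of ★ T1 `K2LiuLocalLFactorDefs`
(RULING M-156i: the normaliser `a_v(s) = aNorm n χ_v vol s` BY NAME), i.e. organ (r2) of O41.6 ∕ the value D1 at rank one: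
* §1 `isUnramifiedChar_chiF`, `unramValue_chiF_eq_prod` — `χ_{F,v} = ∏_w χ_w ∘ ι_w` is unramified when every `χ_w` is, with Satake value `∏_{w∣v} χ_w(ι_w ϖ)`;
* §2 `prod_norm_toPlace_eq_sq`, `prod_norm_toPlace_uniformizer` — **`∏_{w∣v} ‖ι_w y‖_w = ‖y‖_v²`** (local norm compatibility ★ `norm_algebraNorm_localRing` at
  `y ⊗ 1`, `N_{E⊗F_v/F_v}(y ⊗ 1) = y²`), so `∏_{w∣v} ‖ι_w ϖ‖_w = q_v⁻²`;
* §3 `rankOne_scalar_eq` — `(1 − t)/(1 − q_v t) = L_v(2s, χ_F)/L_v(2s+1, χ_F)` (`t = α q_v^{−2s−1}`, `α` the Satake value);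
* §4 **`localIntertwining_eq_aNorm_one_mul`** — `M_v φ (h) = aNorm 1 χ_v (νN(N_Δ ∩ K_v)) s · φ′(h)`: the rank-one instance of the (A4′) normaliser, and the
  first rung («rank-one tower step») of U1-CT-ind stage 3.
HONEST LABEL.  Count-neutral helper; it retires nothing by itself: `HC_CM` is proved only modulo the 7 printed citations (2 remaining named inputs:
hLiu418 = `stmt-HodgeConjecture-24832`, h413 = `stmt-HodgeConjecture-24833`) until rung 0 closes.

## References
* [HarrisKudlaSweet1996] M. Harris, S. Kudla, W. J. Sweet, J. AMS 9 (1996): §6 (6.14)–(6.16) (`a_n/b_n`, `n = 1`: `L(2s,χ)/L(2s+1,χ)`).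
* [Casselman1980] W. Casselman, Compositio Math. 40 (1980): §3 Thm. 3.1.
* [CasselsFrohlichANT1967] Cassels–Fröhlich, *Algebraic Number Theory* (1967): Ch. II §11 (`|N α|_v = ∏_{w∣v} |α|_w`).
* [Tate1950] J. Tate, thesis: §2.5 (local `L`-factor of an unramified character).
-/

set_option autoImplicit false
set_option linter.dupNamespace false -- the mandated namespace repeats `HodgeConjecture.HodgeConjecture`

noncomputable section

open NumberField IsDedekindDomain Matrix MeasureTheory
open scoped NNReal
open Literature.NumberTheory.GaloisRepresentations.IsNonarchimedeanLocalField
open Literature.NumberTheory.GaloisRepresentations.Ultrametric.AdicCompletion (norm_eq_absNorm_zpow two_le_absNorm)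
open Literature.NumberTheory.Automorphic Literature.NumberTheory.Automorphic.UnitaryGroup
open Literature.NumberTheory.GelbartRogawski1991.UnitaryDualPair.LocalSplitting
open Literature.NumberTheory.K2Lit.LocalSiegelDoubled
open Summit.HodgeConjecture.HodgeConjecture.Cruxes.HLiu418.K2LiuLocalLFactorDefs
open Summit.HodgeConjecture.HodgeConjecture.Cruxes.HLiu418.K2LiuGKRankOneIdentity

namespace Summit.HodgeConjecture.HodgeConjecture.Cruxes.HLiu418.K2LiuGKRankOneIdentityLFactor

variable (F : Type) [Field F] [NumberField F] (E : Type) [Field E] [NumberField E] [Algebra F E]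
  (v : HeightOneSpectrum (𝓞 F))

/-! ## §1 `χ_{F,v} = ∏_{w∣v} χ_w ∘ ι_w` is unramified with Satake value `∏_{w∣v} χ_w(ι_w ϖ)` -/

/-- **`χ_{F,v}` is unramified when every `χ_w` is**: `|y|_v = 1 ⟹ |ι_w y|_w = |y|_v^{e(w|v)} = 1` (★ `valued_toPlace`).
[cite: Casselman1980, §3] [cite: Tate1950, §2.5] -/
theorem isUnramifiedChar_chiF (χv : ∀ w : PlacesOver E v, (w.1.adicCompletion E)ˣ →* ℂˣ)
    (hχ : ∀ (w : PlacesOver E v) (u : (w.1.adicCompletion E)ˣ), Valued.v (u : w.1.adicCompletion E) = 1 → χv w u = 1) :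
    IsUnramifiedChar (chiF F E v χv) := by
  intro y hy
  rw [chiF_apply]
  refine Finset.prod_eq_one fun w _ => hχ w _ ?_
  rw [Units.coe_map, MonoidHom.coe_coe, valued_toPlace, hy, one_pow]

/-- **the Satake value of `χ_{F,v}`** is `∏_{w∣v} χ_w(ι_w ϖ)` for any uniformizer `ϖ` of `F_v` (★ T1 `unramValue_eq_apply`).
[cite: Casselman1980, §3] [cite: HarrisKudlaSweet1996, §6 (6.16)] -/
theorem unramValue_chiF_eq_prod (χv : ∀ w : PlacesOver E v, (w.1.adicCompletion E)ˣ →* ℂˣ)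
    (hχ : ∀ (w : PlacesOver E v) (u : (w.1.adicCompletion E)ˣ), Valued.v (u : w.1.adicCompletion E) = 1 → χv w u = 1)
    {ϖ : v.adicCompletion F} (hϖ : Valued.v ϖ = WithZero.exp (-1 : ℤ)) (hϖ0 : ∀ w : PlacesOver E v, toPlace v w ϖ ≠ 0) :
    unramValue F v (chiF F E v χv) = (((∏ w : PlacesOver E v, χv w (Units.mk0 (toPlace v w ϖ) (hϖ0 w))) : ℂˣ) : ℂ) := by
  have hϖ0' : ϖ ≠ 0 := fun h => by rw [h, map_zero] at hϖ; exact WithZero.zero_ne_coe hϖ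
  have hmap : ∀ w : PlacesOver E v,
      Units.map (toPlace v w : v.adicCompletion F →* w.1.adicCompletion E) (Units.mk0 ϖ hϖ0') = Units.mk0 (toPlace v w ϖ) (hϖ0 w) :=
    fun w => Units.ext rfl
  have hprod : chiF F E v χv (Units.mk0 ϖ hϖ0') = ∏ w : PlacesOver E v, χv w (Units.mk0 (toPlace v w ϖ) (hϖ0 w)) := by
    rw [chiF_apply]
    exact Finset.prod_congr rfl fun w _ => by rw [hmap w]
  rw [unramValue_eq_apply F v (isUnramifiedChar_chiF F E v χv hχ) hϖ hϖ0', hprod]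

/-! ## §2 Local norm compatibility on scalars: `∏_{w∣v} ‖ι_w y‖_w = ‖y‖_v²` -/

/-- **`∏_{w∣v} ‖ι_w y‖_w = ‖y‖_v²`** for `y ∈ F_v` and a quadratic extension `E/F`: `∏_w ‖(y ⊗ 1)_w‖_w = ‖N_{E⊗F_v/F_v}(y ⊗ 1)‖_v` (★ `norm_algebraNorm_localRing`)
and `N(y ⊗ 1) = y^{[E⊗F_v : F_v]} = y²` (Mathlib `Algebra.norm_algebraMap`, ★ `finrank_localRing`).  Equivalently `∑_{w∣v} e(w|v) f(w|v) = 2`.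
[cite: CasselsFrohlichANT1967, Ch. II §11] -/
theorem prod_norm_toPlace_eq_sq [Algebra.IsQuadraticExtension F E] (y : v.adicCompletion F) :
    ∏ w : PlacesOver E v, ‖toPlace v w y‖ = ‖y‖ ^ 2 := by
  have h := norm_algebraNorm_localRing E v (toLocalRing E v y)
  simp only [toLocalRing_apply] at h
  rw [← h, ← algebraMap_localRing_eq, Algebra.norm_algebraMap, finrank_localRing, norm_pow]

/-- **`∏_{w∣v} ‖ι_w ϖ‖_w = q_v⁻²`** for a uniformizer `ϖ` of `F_v` (`‖ϖ‖_v = q_v⁻¹`, ★ `norm_eq_absNorm_zpow`, ★ `residueFieldCard_adicCompletion_eq_absNorm`).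
[cite: CasselsFrohlichANT1967, Ch. II §11] [cite: Tate1950, §2.2] -/
theorem prod_norm_toPlace_uniformizer [Algebra.IsQuadraticExtension F E] {ϖ : v.adicCompletion F} (hϖ : Valued.v ϖ = WithZero.exp (-1 : ℤ)) :
    ∏ w : PlacesOver E v, ‖toPlace v w ϖ‖ = ((residueFieldCard (v.adicCompletion F) : ℝ)⁻¹) ^ 2 := by
  rw [prod_norm_toPlace_eq_sq F E v ϖ, norm_eq_absNorm_zpow F v (-1) (by rw [hϖ, WithZero.exp]), _root_.zpow_neg, zpow_one,
    residueFieldCard_adicCompletion_eq_absNorm]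

/-! ## §3 The scalar dictionary `(1 − t)/(1 − q_v t) = L_v(2s, χ_F)/L_v(2s+1, χ_F)` -/

omit [Algebra F E] in
/-- `1 < q_v` as a real number. [folklore] -/
theorem one_lt_residueFieldCard : (1 : ℝ) < (residueFieldCard (v.adicCompletion F) : ℝ) := by
  rw [residueFieldCard_adicCompletion_eq_absNorm]
  exact_mod_cast Nat.lt_of_lt_of_le one_lt_two (two_le_absNorm F v)

/-- **the raw parameter is `t = α · q_v^{−(2s+1)}`**: `(∏_{w∣v} ‖ι_w ϖ‖_w)^{s+½} = q_v^{−(2s+1)}` (complex power of the positive real `q_v⁻²`).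
[cite: HarrisKudlaSweet1996, §6 (6.16)] -/
theorem prod_norm_toPlace_cpow [Algebra.IsQuadraticExtension F E] {ϖ : v.adicCompletion F} (hϖ : Valued.v ϖ = WithZero.exp (-1 : ℤ)) (s : ℂ) :
    (((∏ w : PlacesOver E v, ‖toPlace v w ϖ‖) : ℝ) : ℂ) ^ (s + 1 / 2) = (residueFieldCard (v.adicCompletion F) : ℂ) ^ (-(2 * s + 1)) := by
  have hq : (0 : ℝ) < (residueFieldCard (v.adicCompletion F) : ℝ) := lt_trans one_pos (one_lt_residueFieldCard F v)
  have hq0 : ((residueFieldCard (v.adicCompletion F) : ℕ) : ℂ) ≠ 0 := by exact_mod_cast hq.ne'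
  have hr : (0 : ℝ) < ((residueFieldCard (v.adicCompletion F) : ℝ)⁻¹) ^ 2 := by positivity
  have hr0 : (((((residueFieldCard (v.adicCompletion F) : ℝ)⁻¹) ^ 2 : ℝ)) : ℂ) ≠ 0 := by exact_mod_cast hr.ne'
  rw [prod_norm_toPlace_uniformizer F E v hϖ, Complex.cpow_def_of_ne_zero hr0, Complex.cpow_def_of_ne_zero hq0,
    ← Complex.ofReal_log hr.le, Real.log_pow, Real.log_inv, ← Complex.ofReal_natCast, ← Complex.ofReal_log hq.le]
  congr 1
  push_cast
  ring

/-- `q_v^{−2s} = q_v · q_v^{−(2s+1)}`. [folklore] -/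
theorem residueFieldCard_cpow_neg_two_mul (s : ℂ) :
    (residueFieldCard (v.adicCompletion F) : ℂ) ^ (-(2 * s)) =
      (residueFieldCard (v.adicCompletion F) : ℂ) * (residueFieldCard (v.adicCompletion F) : ℂ) ^ (-(2 * s + 1)) := by
  have hq0 : ((residueFieldCard (v.adicCompletion F) : ℕ) : ℂ) ≠ 0 := by
    exact_mod_cast (lt_trans one_pos (one_lt_residueFieldCard F v)).ne'
  rw [show -(2 * s) = 1 + -(2 * s + 1) by ring, Complex.cpow_add _ _ hq0, Complex.cpow_one]

/-- **THE DICTIONARY (r2)**: with `α = ∏_{w∣v} χ_w(ι_w ϖ)` and `P = ∏_{w∣v} ‖ι_w ϖ‖_w`, the raw Gindikin–Karpelevich scalar of ★ `localIntertwining_eq_rankOne`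
is the `L`-factor ratio of ★ T1: `(1 − α P^{s+½})/(1 − q_v α P^{s+½}) = L_v(2s, χ_F)/L_v(2s+1, χ_F)` (`lF = lFactor F v (chiF χ_v)`, Satake value `α`, `P^{s+½} = q_v^{−2s−1}`).
[cite: HarrisKudlaSweet1996, §6 (6.14)–(6.16)] [cite: Casselman1980, §3 Thm. 3.1] [cite: Tate1950, §2.5] -/
theorem rankOne_scalar_eq [Algebra.IsQuadraticExtension F E] (χv : ∀ w : PlacesOver E v, (w.1.adicCompletion E)ˣ →* ℂˣ)
    (hχ : ∀ (w : PlacesOver E v) (u : (w.1.adicCompletion E)ˣ), Valued.v (u : w.1.adicCompletion E) = 1 → χv w u = 1)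
    {ϖ : v.adicCompletion F} (hϖ : Valued.v ϖ = WithZero.exp (-1 : ℤ)) (hϖ0 : ∀ w : PlacesOver E v, toPlace v w ϖ ≠ 0) (s : ℂ) :
    (1 - (((∏ w : PlacesOver E v, χv w (Units.mk0 (toPlace v w ϖ) (hϖ0 w))) : ℂˣ) : ℂ) *
          (((∏ w : PlacesOver E v, ‖toPlace v w ϖ‖) : ℝ) : ℂ) ^ (s + 1 / 2)) /
        (1 - (residueFieldCard (v.adicCompletion F) : ℂ) *
          ((((∏ w : PlacesOver E v, χv w (Units.mk0 (toPlace v w ϖ) (hϖ0 w))) : ℂˣ) : ℂ) *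
            (((∏ w : PlacesOver E v, ‖toPlace v w ϖ‖) : ℝ) : ℂ) ^ (s + 1 / 2))) =
      lF F E v χv (2 * s) / lF F E v χv (2 * s + 1) := by
  rw [prod_norm_toPlace_cpow F E v hϖ, lF, lF, lFactor_def, lFactor_def, unramValue_chiF_eq_prod F E v χv hχ hϖ hϖ0, inv_div_inv,
    residueFieldCard_cpow_neg_two_mul F v s]
  ring_nf

/-- the size of the raw parameter: `‖α P^{s+½}‖ = ‖α‖ · q_v^{−(2 Re s + 1)}`. [cite: HarrisKudlaSweet1996, §6 (6.16)] -/
theorem norm_rawParam_eq [Algebra.IsQuadraticExtension F E] (χv : ∀ w : PlacesOver E v, (w.1.adicCompletion E)ˣ →* ℂˣ)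
    {ϖ : v.adicCompletion F} (hϖ : Valued.v ϖ = WithZero.exp (-1 : ℤ)) (hϖ0 : ∀ w : PlacesOver E v, toPlace v w ϖ ≠ 0) (s : ℂ) :
    ‖(((∏ w : PlacesOver E v, χv w (Units.mk0 (toPlace v w ϖ) (hϖ0 w))) : ℂˣ) : ℂ) *
        (((∏ w : PlacesOver E v, ‖toPlace v w ϖ‖) : ℝ) : ℂ) ^ (s + 1 / 2)‖ =
      ‖(((∏ w : PlacesOver E v, χv w (Units.mk0 (toPlace v w ϖ) (hϖ0 w))) : ℂˣ) : ℂ)‖ *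
        (residueFieldCard (v.adicCompletion F) : ℝ) ^ (-(2 * s.re + 1)) := by
  have hq : 0 < residueFieldCard (v.adicCompletion F) := by
    have := one_lt_residueFieldCard F v
    exact_mod_cast lt_trans one_pos this
  rw [norm_mul, prod_norm_toPlace_cpow F E v hϖ, Complex.norm_natCast_cpow_of_pos hq]
  congr 2
  simp

/-- **convergence range in plain terms**: if `‖α‖ ≤ 1` (e.g. unitary `χ_w`) and `0 < Re s`, then `‖α P^{s+½}‖ < q_v⁻¹` — the hypothesis `ht` of
★ `localIntertwining_eq_rankOne`. [cite: Casselman1980, §3 Thm. 3.1] -/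
theorem norm_rawParam_lt_of_re_pos [Algebra.IsQuadraticExtension F E] (χv : ∀ w : PlacesOver E v, (w.1.adicCompletion E)ˣ →* ℂˣ)
    {ϖ : v.adicCompletion F} (hϖ : Valued.v ϖ = WithZero.exp (-1 : ℤ)) (hϖ0 : ∀ w : PlacesOver E v, toPlace v w ϖ ≠ 0) {s : ℂ} (hs : 0 < s.re)
    (hα : ‖(((∏ w : PlacesOver E v, χv w (Units.mk0 (toPlace v w ϖ) (hϖ0 w))) : ℂˣ) : ℂ)‖ ≤ 1) :
    ‖(((∏ w : PlacesOver E v, χv w (Units.mk0 (toPlace v w ϖ) (hϖ0 w))) : ℂˣ) : ℂ) *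
        (((∏ w : PlacesOver E v, ‖toPlace v w ϖ‖) : ℝ) : ℂ) ^ (s + 1 / 2)‖ < (residueFieldCard (v.adicCompletion F) : ℝ)⁻¹ := by
  have hq1 := one_lt_residueFieldCard F v
  have hq : (0 : ℝ) < (residueFieldCard (v.adicCompletion F) : ℝ) := lt_trans one_pos hq1
  rw [norm_rawParam_eq F E v χv hϖ hϖ0 s]
  have hlt : (residueFieldCard (v.adicCompletion F) : ℝ) ^ (-(2 * s.re + 1)) < (residueFieldCard (v.adicCompletion F) : ℝ)⁻¹ := by
    rw [← Real.rpow_neg_one]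
    exact Real.rpow_lt_rpow_of_exponent_lt hq1 (by linarith)
  calc _ ≤ 1 * (residueFieldCard (v.adicCompletion F) : ℝ) ^ (-(2 * s.re + 1)) :=
        mul_le_mul_of_nonneg_right hα (Real.rpow_nonneg hq.le _)
    _ < _ := by rw [one_mul]; exact hlt

/-! ## §4 The rank-one Gindikin–Karpelevich identity in `L`-factor currency -/

section Identity

variable [Algebra.IsQuadraticExtension F E] (c : E ≃ₐ[F] E)
  {δ : E} (hcδ : c δ = -δ) (hδ : δ ≠ 0) {d : F} (hd : δ * δ = algebraMap F E d)
  {T₀ : Matrix (Fin 1) (Fin 1) F} (hT₀ : T₀.IsSymm) (hT₀d : IsUnit T₀.det)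
  {JD : Matrix (Fin (1 + 1)) (Fin (1 + 1)) E} (hJD : JD = (gramD F 1 T₀).map (algebraMap F E))

include hT₀d in
/-- **RANK-ONE GINDIKIN–KARPELEVICH IN `L`-FACTOR CURRENCY (D1 at `n = 1`; the «`aNorm_one` bridge»).**  At a place with `|2|_w = |δ|_w = 1`, `T₀`, `T₀⁻¹`
integral and `χ_w` unramified at every `w ∣ v`, for a Haar measure `νN` on `N_Δ(F_v)`, `φ` spherical in `I_v(s, χ_v)`, `φ′` spherical in `I_v(−s, χ′_v)`
(`χ′_w = (χ_{w′})⁻¹ ∘ c_w`), a uniformizer `ϖ` of `F_v` in the convergence range `‖α‖ q_v^{−2 Re s − 1} < q_v⁻¹`: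
`M_v φ (h) = aNorm 1 χ_v (νN(N_Δ(F_v) ∩ K_v)) s · φ′(h) = νN(N_Δ ∩ K_v) · L_v(2s, χ_F)/L_v(2s+1, χ_F) · φ′(h)` for every `h ∈ H(F_v)` — ★ `localIntertwining_eq_rankOne`
read through `rankOne_scalar_eq` and ★ T1 `aNorm_one`.  This is the value `a_v(s)` of RULING M-156i's normaliser on the spherical vector at `n = 1`.
[cite: HarrisKudlaSweet1996, §6 (6.14)–(6.16)] [cite: Casselman1980, §3 Thm. 3.1] -/
theorem localIntertwining_eq_aNorm_one_mul [MeasurableSpace (v.adicCompletion F)] [BorelSpace (v.adicCompletion F)]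
    [MeasurableSpace (unipDeltaLocal F E c v 1 (JD := JD))] [BorelSpace (unipDeltaLocal F E c v 1 (JD := JD))]
    (νN : Measure (unipDeltaLocal F E c v 1 (JD := JD))) [νN.IsHaarMeasure]
    (χv χv' : ∀ w : PlacesOver E v, (w.1.adicCompletion E)ˣ →* ℂˣ)
    (hχ' : ∀ (w w' : PlacesOver E v) (h : c • w.1 = w'.1),
      χv' w = (χv w')⁻¹.comp (Units.map (galAdicCompletionMap (L := E) c h : w.1.adicCompletion E →* w'.1.adicCompletion E)))
    (s : ℂ) {φ φ' : UnitaryGroup.localPi E c (1 + 1) JD v → ℂ} (hφ : IsSphericalSection F E c hcδ hδ hd v 1 hT₀ hJD χv s φ)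
    (hφ' : IsSphericalSection F E c hcδ hδ hd v 1 hT₀ hJD χv' (-s) φ')
    (h2 : ∀ w : PlacesOver E v, ValuativeRel.valuation (w.1.adicCompletion E) (2 : w.1.adicCompletion E) = 1)
    (hT : ∀ (w : PlacesOver E v) (i j : Fin 1),
      ValuativeRel.valuation (w.1.adicCompletion E) (algebraMap E (w.1.adicCompletion E) (algebraMap F E (T₀ i j))) ≤ 1)
    (hTinv : ∀ (w : PlacesOver E v) (i j : Fin 1),
      ValuativeRel.valuation (w.1.adicCompletion E) (algebraMap E (w.1.adicCompletion E) (algebraMap F E (T₀⁻¹ i j))) ≤ 1)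
    (hδw : ∀ w : PlacesOver E v, Valued.v ((δ : E) : w.1.adicCompletion E) = 1)
    (hχ : ∀ (w : PlacesOver E v) (u : (w.1.adicCompletion E)ˣ), Valued.v (u : w.1.adicCompletion E) = 1 → χv w u = 1)
    {ϖ : v.adicCompletion F} (hϖ : Valued.v ϖ = WithZero.exp (-1 : ℤ)) (hϖ0 : ∀ w : PlacesOver E v, toPlace v w ϖ ≠ 0)
    (ht : ‖(((∏ w : PlacesOver E v, χv w (Units.mk0 (toPlace v w ϖ) (hϖ0 w))) : ℂˣ) : ℂ) *
          (((∏ w : PlacesOver E v, ‖toPlace v w ϖ‖) : ℝ) : ℂ) ^ (s + 1 / 2)‖ < (residueFieldCard (v.adicCompletion F) : ℝ)⁻¹)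
    (h : UnitaryGroup.localPi E c (1 + 1) JD v) :
    localIntertwining F E c v 1 hJD νN φ h =
      aNorm F E c v 1 χv (νN.real {u | (u : UnitaryGroup.localPi E c (1 + 1) JD v) ∈ UnitaryGroup.localInt E c (1 + 1) JD v}) s * φ' h := by
  rw [localIntertwining_eq_rankOne F E c hcδ hδ hd v hT₀ hT₀d hJD νN χv χv' hχ' s hφ hφ' h2 hT hTinv hδw hχ hϖ hϖ0 ht h, aNorm_one,
    rankOne_scalar_eq F E v χv hχ hϖ hϖ0 s]

include hT₀d in
/-- **The same on the half-plane `0 < Re s` for characters with `‖∏_{w∣v} χ_w(ι_w ϖ)‖ ≤ 1`** (e.g. unitary): the convergence hypothesis `ht` of ★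
`localIntertwining_eq_rankOne` discharged by `norm_rawParam_lt_of_re_pos`. [cite: HarrisKudlaSweet1996, §6 (6.14)–(6.16)] [cite: Casselman1980, §3 Thm. 3.1] -/
theorem localIntertwining_eq_aNorm_one_mul_of_re_pos [MeasurableSpace (v.adicCompletion F)] [BorelSpace (v.adicCompletion F)]
    [MeasurableSpace (unipDeltaLocal F E c v 1 (JD := JD))] [BorelSpace (unipDeltaLocal F E c v 1 (JD := JD))]
    (νN : Measure (unipDeltaLocal F E c v 1 (JD := JD))) [νN.IsHaarMeasure]
    (χv χv' : ∀ w : PlacesOver E v, (w.1.adicCompletion E)ˣ →* ℂˣ)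
    (hχ' : ∀ (w w' : PlacesOver E v) (h : c • w.1 = w'.1),
      χv' w = (χv w')⁻¹.comp (Units.map (galAdicCompletionMap (L := E) c h : w.1.adicCompletion E →* w'.1.adicCompletion E)))
    {s : ℂ} (hs : 0 < s.re) {φ φ' : UnitaryGroup.localPi E c (1 + 1) JD v → ℂ} (hφ : IsSphericalSection F E c hcδ hδ hd v 1 hT₀ hJD χv s φ)
    (hφ' : IsSphericalSection F E c hcδ hδ hd v 1 hT₀ hJD χv' (-s) φ')
    (h2 : ∀ w : PlacesOver E v, ValuativeRel.valuation (w.1.adicCompletion E) (2 : w.1.adicCompletion E) = 1)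
    (hT : ∀ (w : PlacesOver E v) (i j : Fin 1),
      ValuativeRel.valuation (w.1.adicCompletion E) (algebraMap E (w.1.adicCompletion E) (algebraMap F E (T₀ i j))) ≤ 1)
    (hTinv : ∀ (w : PlacesOver E v) (i j : Fin 1),
      ValuativeRel.valuation (w.1.adicCompletion E) (algebraMap E (w.1.adicCompletion E) (algebraMap F E (T₀⁻¹ i j))) ≤ 1)
    (hδw : ∀ w : PlacesOver E v, Valued.v ((δ : E) : w.1.adicCompletion E) = 1)
    (hχ : ∀ (w : PlacesOver E v) (u : (w.1.adicCompletion E)ˣ), Valued.v (u : w.1.adicCompletion E) = 1 → χv w u = 1)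
    {ϖ : v.adicCompletion F} (hϖ : Valued.v ϖ = WithZero.exp (-1 : ℤ)) (hϖ0 : ∀ w : PlacesOver E v, toPlace v w ϖ ≠ 0)
    (hα : ‖(((∏ w : PlacesOver E v, χv w (Units.mk0 (toPlace v w ϖ) (hϖ0 w))) : ℂˣ) : ℂ)‖ ≤ 1)
    (h : UnitaryGroup.localPi E c (1 + 1) JD v) :
    localIntertwining F E c v 1 hJD νN φ h =
      aNorm F E c v 1 χv (νN.real {u | (u : UnitaryGroup.localPi E c (1 + 1) JD v) ∈ UnitaryGroup.localInt E c (1 + 1) JD v}) s * φ' h :=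
  localIntertwining_eq_aNorm_one_mul F E v c hcδ hδ hd hT₀ hT₀d hJD νN χv χv' hχ' s hφ hφ' h2 hT hTinv hδw hχ hϖ hϖ0
    (norm_rawParam_lt_of_re_pos F E v χv hϖ hϖ0 hs hα) h

end Identity

end Summit.HodgeConjecture.HodgeConjecture.Cruxes.HLiu418.K2LiuGKRankOneIdentityLFactor

end
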